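import Summits.CriticalPhenomena.SAWScalingLimit.Theorems.SAWDefectDecoherenceBoundaryClosureRZigzagDiscretisationThresholds
import Summits.CriticalPhenomena.SAWScalingLimit.Theorems.SAWDefectDecoherenceBoundaryClosureRZigzagDiscretisationStructure
import Summits.CriticalPhenomena.SAWScalingLimit.Theorems.SAWDefectDecoherencePolygonParitySqueezeDefs
import HarnessLib

/-!
# Crux `BoundaryClosureR` (stmt-CriticalPhenomena-14004), line `polygon-parity-squeeze`,
# stub `stub_innerPolygonsOfZigzag` (7b): the two pins of the trimmed discretisation

Landing target:
`Summits/CriticalPhenomena/SAWScalingLimit/Theorems/SAWDefectDecoherenceBoundaryClosureRZigzagDiscretisationPins.lean`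
(`--supports stmt-CriticalPhenomena-14004`; building block of the registered stub
`stub_innerPolygonsOfZigzag`, the lattice half of the inner-polygon construction (IP)).

The test thresholds `zdT` of the trimmed discretisation are the PINS `m δ`, `m₀ δ` on the two pinned
segments (the frontier of the inner polygon on the horizontal lines through `pt 1`, `pt 0`, within
`ρ`, `r₁`) and float-shifted least thresholds elsewhere.  This file supplies what makes the two
regimes fit:

* `gap_pin` — **the gap**: a frontier point of `P` on the gate line at distance `< ρ` from `pt 1` is
  in fact at distance `< 15ρ/16` (beyond, the frontier lies in `Ω`, which near `pt 1` is the open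
  upper half-ball); `zone_of_segment` — hence a frontier SEGMENT on the gate line meeting the pinned
  disc stays in it (intermediate value theorem), and `zdT_eq_of_segment` — **collinear chart centres
  joined by a frontier segment carry the same test threshold**;
* `zdThr_zero_le_of_floorEdge`, `eventually_zdThr_le_gatePin`, `eventually_zdThr_le_rootPin` — the
  pins are at least the least exact thresholds (the up face of the normaliser's floor mid-edge lies
  in `Λ δ`, hence strictly above the line), so `eventually_zdThr_le_zdT`: every test threshold is at
  least the least threshold — passing a test puts the face strictly inside the chart's half-plane;
* `tendsto_delta_mul_zdThr`, `tendsto_delta_mul_float` — `δ·zdThr k z δ → (2√3/3)·level`, and with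
  `GateMass.tendsto_floorHeight` the float `u δ = |m δ - zdThr 0 (pt 1) δ| + |m₀ δ - zdThr 0 (pt 0) δ| + 2`
  satisfies `δ·u δ → 0` (`eventually_delta_mul_float_le`).

Sources: H. Duminil-Copin, S. Smirnov, Ann. of Math. 175 (2012) §2–§3.  No proposition is defined and
no named fact is introduced.
-/

noncomputable section

open scoped ComplexConjugate Topology
open Set Metric Filter
open Literature.Probability.LatticeModels Literature.Probability.RandomPlanarGeometry
  Literature.Probability.RandomPlanarGeometry.SAW
open Summit.CriticalPhenomena.SAWScalingLimit.Theorems.PolygonParitySqueeze.InnerZigzag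
  (level_split level_add_smul halfPlane_eq_of_level_eq_zero)
open Summit.CriticalPhenomena.SAWScalingLimit.Theorems.PickHalfPlane.GateMass
  (eventually_exists_eq_floorEdge tendsto_floorHeight smul_hexCenter_mem_ball floorEdge_mem_edgeSet)

namespace Summit.CriticalPhenomena.SAWScalingLimit.Theorems.PolygonParitySqueeze.ZigzagDiscretisation

/-! ### 1. The gap and the zones along frontier segments -/

/-- **The gap at a pin.**  `Ω ∩ ball x R` is the open upper half-ball, the frontier of `P` off
`ball x (15R/16) ∪ ball x' (15R'/16)` lies in `Ω`, and the two pinned discs are `R + R'` apart: then a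
frontier point of `P` on the horizontal line through `x` within `R` of `x` is within `15R/16`.
[folklore] -/
theorem gap_pin {D : DobrushinDomain} {S : Set ℂ} {x x' : ℂ} {R R' : ℝ}
    (hDx : D.carrier ∩ ball x R = {z : ℂ | x.im < z.im} ∩ ball x R)
    (hF : ∀ w ∈ frontier S, w ∉ ball x (15 * R / 16) → w ∉ ball x' (15 * R' / 16) → w ∈ D.carrier)
    (hRR : R + R' ≤ dist x x') (hR' : 0 ≤ R')
    {z : ℂ} (hz : z ∈ frontier S) (hzim : z.im = x.im) (hzd : dist z x < R) : dist z x < 15 * R / 16 := by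
  by_contra hcon
  push Not at hcon
  have h1 : z ∉ ball x (15 * R / 16) := fun h => by rw [mem_ball] at h; linarith
  have h2 : z ∉ ball x' (15 * R' / 16) := fun h => by
    rw [mem_ball] at h
    have := dist_triangle x z x'
    rw [dist_comm x z] at this
    linarith
  have hzD : z ∈ D.carrier ∩ ball x R := ⟨hF z hz h1 h2, mem_ball.2 hzd⟩
  rw [hDx] at hzD
  have := hzD.1
  rw [mem_setOf_eq, hzim] at this
  exact lt_irrefl _ this

/-- **A frontier segment on the pinned line meeting the pinned disc stays in it** (intermediate value
theorem + the gap). [folklore] -/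
theorem zone_of_segment {D : DobrushinDomain} {S : Set ℂ} {x x' : ℂ} {R R' : ℝ}
    (hDx : D.carrier ∩ ball x R = {z : ℂ | x.im < z.im} ∩ ball x R)
    (hF : ∀ w ∈ frontier S, w ∉ ball x (15 * R / 16) → w ∉ ball x' (15 * R' / 16) → w ∈ D.carrier)
    (hRR : R + R' ≤ dist x x') (hR' : 0 ≤ R')
    {z z' : ℂ} (hseg : segment ℝ z z' ⊆ frontier S) (hzim : z.im = x.im) (hz'im : z'.im = x.im)
    (hzd : dist z x < R) : dist z' x < R := by
  by_contra hcon
  push Not at hcon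
  have hz : z ∈ frontier S := hseg (left_mem_segment ℝ z z')
  have hgap := gap_pin hDx hF hRR hR' hz hzim hzd
  have hR : 0 < R := lt_of_le_of_lt dist_nonneg hzd
  set f : ℝ → ℝ := fun t => dist (z + t • (z' - z)) x with hf
  have hfc : Continuous f := by rw [hf]; fun_prop
  have hf0 : f 0 = dist z x := by simp [hf]
  have hf1 : f 1 = dist z' x := by simp [hf]
  have hmem : 31 * R / 32 ∈ Icc (f 0) (f 1) := ⟨by rw [hf0]; linarith, by rw [hf1]; linarith⟩
  obtain ⟨t, ht, hft⟩ := intermediate_value_Icc zero_le_one hfc.continuousOn hmem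
  set w : ℂ := z + t • (z' - z) with hw
  have hwseg : w ∈ segment ℝ z z' := by rw [segment_eq_image']; exact ⟨t, ht, rfl⟩
  have hwim : w.im = x.im := by
    rw [hw, Complex.add_im, Complex.real_smul, Complex.mul_im, Complex.ofReal_re, Complex.ofReal_im,
      Complex.sub_im, hzim, hz'im]; ring
  have hwd : dist w x < R := by rw [show dist w x = f t from rfl, hft]; linarith
  have := gap_pin hDx hF hRR hR' (hseg hwseg) hwim hwd
  rw [show dist w x = f t from rfl, hft] at this
  linarith

/-- The zone condition is constant along a frontier segment on the pinned line. [folklore] -/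
theorem zone_iff_of_segment {D : DobrushinDomain} {S : Set ℂ} {x x' : ℂ} {R R' : ℝ}
    (hDx : D.carrier ∩ ball x R = {z : ℂ | x.im < z.im} ∩ ball x R)
    (hF : ∀ w ∈ frontier S, w ∉ ball x (15 * R / 16) → w ∉ ball x' (15 * R' / 16) → w ∈ D.carrier)
    (hRR : R + R' ≤ dist x x') (hR' : 0 ≤ R')
    {z z' : ℂ} (hseg : segment ℝ z z' ⊆ frontier S) (him : z'.im = z.im) :
    (z'.im = x.im ∧ dist z' x < R) ↔ (z.im = x.im ∧ dist z x < R) := by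
  constructor
  · rintro ⟨h1, h2⟩
    have hseg' : segment ℝ z' z ⊆ frontier S := by rw [segment_symm]; exact hseg
    exact ⟨him ▸ h1, zone_of_segment hDx hF hRR hR' hseg' h1 (him ▸ h1) h2⟩
  · rintro ⟨h1, h2⟩
    exact ⟨him.trans h1, zone_of_segment hDx hF hRR hR' hseg h1 (him.trans h1) h2⟩

/-- **Collinear chart centres joined by a frontier segment carry the same test threshold.**
[folklore] -/
theorem zdT_eq_of_segment {D : DobrushinDomain} {S : Set ℂ} {x₁ x₀ : ℂ} {ρ r₁ : ℝ}
    (hD1 : D.carrier ∩ ball x₁ ρ = {z : ℂ | x₁.im < z.im} ∩ ball x₁ ρ)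
    (hD0 : D.carrier ∩ ball x₀ r₁ = {z : ℂ | x₀.im < z.im} ∩ ball x₀ r₁)
    (hF : ∀ w ∈ frontier S, w ∉ ball x₁ (15 * ρ / 16) → w ∉ ball x₀ (15 * r₁ / 16) → w ∈ D.carrier)
    (hsep : ρ + r₁ ≤ dist x₀ x₁) (hρ : 0 ≤ ρ) (hr₁ : 0 ≤ r₁)
    (m m₀ : ℤ) (δ : ℝ) (k : Fin 6) {z z' : ℂ} (hseg : segment ℝ z z' ⊆ frontier S)
    (hl : ((z' - z) * conj (innerNormal k)).re = 0) :
    zdT x₁ x₀ ρ r₁ m m₀ δ k z' = zdT x₁ x₀ ρ r₁ m m₀ δ k z := by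
  have hthr : zdThr k z' δ = zdThr k z δ := (zdThr_congr k δ (level_eq_of_sub_level_eq_zero k hl)).symm
  by_cases hk : k = 0
  · subst hk
    have him : z'.im = z.im := by
      have := hl
      rw [sub_mul, Complex.sub_re, level_zero_eq_im, level_zero_eq_im] at this
      linarith
    have h1 := zone_iff_of_segment hD1 hF (by rwa [dist_comm]) hr₁ hseg him
    have h0 := zone_iff_of_segment hD0 (fun w hw h0 h1 => hF w hw h1 h0) (by rwa [add_comm]) hρ hseg him
    rw [zdT, zdT, hthr]
    simp only [true_and, h1, h0]
  · simp [zdT, hk, hthr]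

/-! ### 2. The pins are at least the least thresholds -/

/-- **The up face of a floor mid-edge of the pinned row near the pin is strictly above the line**, so
the pin row is at least the least threshold row `zdThr 0 x δ`. [folklore] -/
theorem zdThr_zero_le_of_floorEdge {D : DobrushinDomain} {Λ' : Finset HexVertex} {x : ℂ} {R δ : ℝ}
    {mr kc : ℤ} (hδ : 0 < δ) (hδR : δ < R)
    (hDx : D.carrier ∩ ball x R = {z : ℂ | x.im < z.im} ∩ ball x R)
    (hcar : ∀ v ∈ Λ', (δ : ℂ) * hexCenter v ∈ D.carrier)
    (hpin : ∀ v : HexVertex, (δ : ℂ) * hexCenter v ∈ ball x R → (v ∈ Λ' ↔ mr ≤ v.1 1))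
    (hmid : (δ : ℂ) * hexMidpoint s((((![kc, mr - 1] : Site 2)), (1 : Fin 2)), ((![kc, mr] : Site 2), (0 : Fin 2))) ∈
      ball x (R / 2)) : zdThr 0 x δ ≤ mr := by
  set v : HexVertex := ((![kc, mr] : Site 2), (0 : Fin 2)) with hv
  have hball : (δ : ℂ) * hexCenter v ∈ ball x R := by
    refine smul_hexCenter_mem_ball hδ.le (floorEdge_mem_edgeSet kc mr) (Sym2.mem_mk_right _ _) ?_
    have : dist ((δ : ℂ) * hexMidpoint s((((![kc, mr - 1] : Site 2)), (1 : Fin 2)), ((![kc, mr] : Site 2), (0 : Fin 2)))) x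
        < R / 2 := hmid
    linarith
  have hvΛ : v ∈ Λ' := (hpin v hball).2 (by simp [hv])
  have hvD : (δ : ℂ) * hexCenter v ∈ D.carrier ∩ ball x R := ⟨hcar v hvΛ, hball⟩
  rw [hDx] at hvD
  have := zdThr_zero_le_row x hδ (![kc, mr]) hvD.1
  simpa using this

/-- **Eventually the gate pin is at least the least threshold**: `zdThr 0 (pt 1) δ ≤ m δ`. [folklore] -/
theorem eventually_zdThr_le_gatePin {D : DobrushinDomain} {ρ : ℝ} {Λ : ℝ → Finset HexVertex} {m : ℝ → ℤ}
    {b : ℝ → Sym2 HexVertex} (hA : AdmissibleFamily D ρ Λ m b) :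
    ∀ᶠ δ : ℝ in 𝓝[>] 0, zdThr 0 (D.pt 1) δ ≤ m δ := by
  obtain ⟨hρ, hD1, hev, -, hlim⟩ := hA
  have hpin : ∀ᶠ δ : ℝ in 𝓝[>] 0, ∀ v : HexVertex,
      (δ : ℂ) * hexCenter v ∈ ball (D.pt 1) ρ → (v ∈ Λ δ ↔ m δ ≤ v.1 1) := hev.mono fun δ h => h.2.2.2.2
  have hb : ∀ᶠ δ : ℝ in 𝓝[>] 0, b δ ∈ hexDomainBoundary (Λ δ) := hev.mono fun δ h => h.2.1
  have hnear : ∀ᶠ δ : ℝ in 𝓝[>] 0, (δ : ℂ) * hexMidpoint (b δ) ∈ ball (D.pt 1) (ρ / 2) :=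
    hlim (ball_mem_nhds _ (half_pos hρ))
  have hδ : ∀ᶠ δ : ℝ in 𝓝[>] 0, δ ∈ Ioo 0 ρ := Ioo_mem_nhdsGT hρ
  filter_upwards [eventually_exists_eq_floorEdge hρ hpin hb hlim, hev, hnear, hδ] with δ ⟨kc, hk⟩ hevδ hnearδ hδδ
  rw [hk] at hnearδ
  exact zdThr_zero_le_of_floorEdge hδδ.1 hδδ.2 hD1 hevδ.2.2.2.1 hevδ.2.2.2.2 hnearδ

/-- **Eventually the root pin is at least the least threshold**: `zdThr 0 (pt 0) δ ≤ m₀ δ`. [folklore] -/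
theorem eventually_zdThr_le_rootPin {D : DobrushinDomain} {ρ : ℝ} {Λ : ℝ → Finset HexVertex} {m : ℝ → ℤ}
    {b : ℝ → Sym2 HexVertex} (hA : AdmissibleFamily D ρ Λ m b) {a : ℝ → Sym2 HexVertex} {r₀ : ℝ} {m₀ : ℝ → ℤ}
    (hP : PinnedFlatRoot D Λ b (D.pt 0) a r₀ m₀) :
    ∀ᶠ δ : ℝ in 𝓝[>] 0, zdThr 0 (D.pt 0) δ ≤ m₀ δ := by
  obtain ⟨-, -, hev, -, -⟩ := hA
  obtain ⟨hr₀, hD0, hev0, hlim⟩ := hP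
  have hpin : ∀ᶠ δ : ℝ in 𝓝[>] 0, ∀ v : HexVertex,
      (δ : ℂ) * hexCenter v ∈ ball (D.pt 0) r₀ → (v ∈ Λ δ ↔ m₀ δ ≤ v.1 1) := hev0.mono fun δ h => h.2.2
  have ha : ∀ᶠ δ : ℝ in 𝓝[>] 0, a δ ∈ hexDomainBoundary (Λ δ) := hev0.mono fun δ h => h.1
  have hnear : ∀ᶠ δ : ℝ in 𝓝[>] 0, (δ : ℂ) * hexMidpoint (a δ) ∈ ball (D.pt 0) (r₀ / 2) :=
    hlim (ball_mem_nhds _ (half_pos hr₀))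
  have hδ : ∀ᶠ δ : ℝ in 𝓝[>] 0, δ ∈ Ioo 0 r₀ := Ioo_mem_nhdsGT hr₀
  filter_upwards [eventually_exists_eq_floorEdge hr₀ hpin ha hlim, hev, hpin, hnear, hδ] with δ ⟨kc, hk⟩ hevδ hpinδ hnearδ hδδ
  rw [hk] at hnearδ
  exact zdThr_zero_le_of_floorEdge hδδ.1 hδδ.2 hD0 hevδ.2.2.2.1 hpinδ hnearδ

/-- **Every test threshold is at least the least exact threshold** once the pins are. [folklore] -/
theorem zdThr_le_zdT (x₁ x₀ : ℂ) (ρ r₁ : ℝ) {m m₀ : ℤ} {δ : ℝ} (h₁ : zdThr 0 x₁ δ ≤ m) (h₀ : zdThr 0 x₀ δ ≤ m₀)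
    (k : Fin 6) (z : ℂ) : zdThr k z δ ≤ zdT x₁ x₀ ρ r₁ m m₀ δ k z := by
  unfold zdT
  split_ifs with ha hb
  · obtain ⟨rfl, hz, -⟩ := ha
    rw [zdThr_congr 0 δ (show (z * conj (innerNormal 0)).re = (x₁ * conj (innerNormal 0)).re by
      rw [level_zero_eq_im, level_zero_eq_im, hz])]
    exact h₁
  · obtain ⟨rfl, hz, -⟩ := hb
    rw [zdThr_congr 0 δ (show (z * conj (innerNormal 0)).re = (x₀ * conj (innerNormal 0)).re by
      rw [level_zero_eq_im, level_zero_eq_im, hz])]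
    exact h₀
  · have := abs_nonneg (m - zdThr 0 x₁ δ)
    have := abs_nonneg (m₀ - zdThr 0 x₀ δ)
    linarith

/-- **Eventually every test threshold is at least the least threshold**; then passing a test puts
the scaled centre strictly inside the chart's half-plane. [folklore] -/
theorem eventually_zdThr_le_zdT {D : DobrushinDomain} {ρ : ℝ} {Λ : ℝ → Finset HexVertex} {m : ℝ → ℤ}
    {b : ℝ → Sym2 HexVertex} (hA : AdmissibleFamily D ρ Λ m b) {a : ℝ → Sym2 HexVertex} {r₀ : ℝ} {m₀ : ℝ → ℤ}
    (hP : PinnedFlatRoot D Λ b (D.pt 0) a r₀ m₀) (ρ' r₁ : ℝ) :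
    ∀ᶠ δ : ℝ in 𝓝[>] 0, ∀ (k : Fin 6) (z : ℂ), zdThr k z δ ≤ zdT (D.pt 1) (D.pt 0) ρ' r₁ (m δ) (m₀ δ) δ k z := by
  filter_upwards [eventually_zdThr_le_gatePin hA, eventually_zdThr_le_rootPin hA hP] with δ h1 h0 k z
  exact zdThr_le_zdT _ _ _ _ h1 h0 k z

/-! ### 3. The float is `o(1/δ)` -/

/-- **`δ·zdThr k z δ → (2√3/3)·Re(z conj n_k)`** as `δ → 0⁺`. [folklore] -/
theorem tendsto_delta_mul_zdThr (k : Fin 6) (z : ℂ) :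
    Tendsto (fun δ : ℝ => δ * (zdThr k z δ : ℝ)) (𝓝[>] 0)
      (𝓝 (2 * Real.sqrt 3 / 3 * (z * conj (innerNormal k)).re)) := by
  set L : ℝ := (z * conj (innerNormal k)).re with hL
  set mk : ℝ := (3 * (-1 : ℝ) ^ (k : ℕ) - 1) / 2 with hmk
  -- lower and upper envelopes
  have hlo : Tendsto (fun δ : ℝ => 2 * Real.sqrt 3 / 3 * L - δ * (mk / 3)) (𝓝[>] 0)
      (𝓝 (2 * Real.sqrt 3 / 3 * L)) := by
    have : Tendsto (fun δ : ℝ => 2 * Real.sqrt 3 / 3 * L - δ * (mk / 3)) (𝓝 0)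
        (𝓝 (2 * Real.sqrt 3 / 3 * L - 0 * (mk / 3))) :=
      tendsto_const_nhds.sub (tendsto_id.mul tendsto_const_nhds)
    rw [zero_mul, sub_zero] at this
    exact this.mono_left nhdsWithin_le_nhds
  have hhi : Tendsto (fun δ : ℝ => 2 * Real.sqrt 3 / 3 * L - δ * (mk / 3) + δ) (𝓝[>] 0)
      (𝓝 (2 * Real.sqrt 3 / 3 * L)) := by
    have : Tendsto (fun δ : ℝ => 2 * Real.sqrt 3 / 3 * L - δ * (mk / 3) + δ) (𝓝 0)
        (𝓝 (2 * Real.sqrt 3 / 3 * L - 0 * (mk / 3) + 0)) :=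
      (tendsto_const_nhds.sub (tendsto_id.mul tendsto_const_nhds)).add tendsto_id
    rw [zero_mul, sub_zero, add_zero] at this
    exact this.mono_left nhdsWithin_le_nhds
  refine tendsto_of_tendsto_of_tendsto_of_le_of_le' hlo hhi ?_ ?_
  · filter_upwards [self_mem_nhdsWithin] with δ (hδ : 0 < δ)
    have hfl : (2 * Real.sqrt 3 * L / δ - mk) / 3 < (⌊(2 * Real.sqrt 3 * L / δ - mk) / 3⌋ : ℝ) + 1 :=
      Int.lt_floor_add_one _
    have e : (zdThr k z δ : ℝ) = (⌊(2 * Real.sqrt 3 * L / δ - mk) / 3⌋ : ℝ) + 1 := by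
      rw [zdThr, ← hL, ← hmk]; push_cast; ring
    rw [e]
    have : δ * ((2 * Real.sqrt 3 * L / δ - mk) / 3) = 2 * Real.sqrt 3 / 3 * L - δ * (mk / 3) := by
      field_simp
    nlinarith
  · filter_upwards [self_mem_nhdsWithin] with δ (hδ : 0 < δ)
    have hfl : (⌊(2 * Real.sqrt 3 * L / δ - mk) / 3⌋ : ℝ) ≤ (2 * Real.sqrt 3 * L / δ - mk) / 3 := Int.floor_le _
    have e : (zdThr k z δ : ℝ) = (⌊(2 * Real.sqrt 3 * L / δ - mk) / 3⌋ : ℝ) + 1 := by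
      rw [zdThr, ← hL, ← hmk]; push_cast; ring
    rw [e]
    have : δ * ((2 * Real.sqrt 3 * L / δ - mk) / 3) = 2 * Real.sqrt 3 / 3 * L - δ * (mk / 3) := by
      field_simp
    nlinarith

/-- **`δ·(pin row) → (2√3/3)·(height of the pin)`** for a pinned family (from
`GateMass.tendsto_floorHeight`). [folklore] -/
theorem tendsto_delta_mul_pin {Λ : ℝ → Finset HexVertex} {mr : ℝ → ℤ} {R : ℝ} {x : ℂ} {e : ℝ → Sym2 HexVertex}
    (hR : 0 < R)
    (hpin : ∀ᶠ δ : ℝ in 𝓝[>] 0, ∀ v : HexVertex, (δ : ℂ) * hexCenter v ∈ ball x R → (v ∈ Λ δ ↔ mr δ ≤ v.1 1))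
    (he : ∀ᶠ δ : ℝ in 𝓝[>] 0, e δ ∈ hexDomainBoundary (Λ δ))
    (hlim : Tendsto (fun δ : ℝ => (δ : ℂ) * hexMidpoint (e δ)) (𝓝[>] 0) (𝓝 x)) :
    Tendsto (fun δ : ℝ => δ * (mr δ : ℝ)) (𝓝[>] 0) (𝓝 (2 * Real.sqrt 3 / 3 * x.im)) := by
  have h := tendsto_floorHeight hR hpin he hlim
  have h3 : Real.sqrt 3 * Real.sqrt 3 = 3 := Real.mul_self_sqrt (by norm_num)
  have h3p : 0 < Real.sqrt 3 := Real.sqrt_pos.2 (by norm_num)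
  have := h.mul_const (2 / Real.sqrt 3)
  have e1 : x.im * (2 / Real.sqrt 3) = 2 * Real.sqrt 3 / 3 * x.im := by
    have hsq : Real.sqrt 3 ^ 2 = 3 := by rw [sq]; exact h3
    field_simp; linear_combination (-x.im) * hsq
  rw [e1] at this
  refine this.congr fun δ => ?_
  field_simp

/-- **The float is `o(1/δ)`**: `δ·(|m δ - zdThr 0 (pt 1) δ| + |m₀ δ - zdThr 0 (pt 0) δ| + 2) → 0`.
[folklore] -/
theorem tendsto_delta_mul_float {D : DobrushinDomain} {ρ : ℝ} {Λ : ℝ → Finset HexVertex} {m : ℝ → ℤ}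
    {b : ℝ → Sym2 HexVertex} (hA : AdmissibleFamily D ρ Λ m b) {a : ℝ → Sym2 HexVertex} {r₀ : ℝ} {m₀ : ℝ → ℤ}
    (hP : PinnedFlatRoot D Λ b (D.pt 0) a r₀ m₀) :
    Tendsto (fun δ : ℝ => δ * ((|m δ - zdThr 0 (D.pt 1) δ| + |m₀ δ - zdThr 0 (D.pt 0) δ| + 2 : ℤ) : ℝ))
      (𝓝[>] 0) (𝓝 0) := by
  obtain ⟨hρ, -, hev, -, hlim⟩ := hA
  obtain ⟨hr₀, -, hev0, hlim0⟩ := hP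
  have hm := tendsto_delta_mul_pin (x := D.pt 1) hρ (hev.mono fun δ h => h.2.2.2.2) (hev.mono fun δ h => h.2.1) hlim
  have hm₀ := tendsto_delta_mul_pin (x := D.pt 0) hr₀ (hev0.mono fun δ h => h.2.2) (hev0.mono fun δ h => h.1) hlim0
  have ht1 := tendsto_delta_mul_zdThr 0 (D.pt 1)
  have ht0 := tendsto_delta_mul_zdThr 0 (D.pt 0)
  rw [level_zero_eq_im] at ht1 ht0
  have hs1 : Tendsto (fun δ : ℝ => |δ * (m δ : ℝ) - δ * (zdThr 0 (D.pt 1) δ : ℝ)|) (𝓝[>] 0) (𝓝 0) := by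
    have := (hm.sub ht1).abs; rwa [sub_self, abs_zero] at this
  have hs0 : Tendsto (fun δ : ℝ => |δ * (m₀ δ : ℝ) - δ * (zdThr 0 (D.pt 0) δ : ℝ)|) (𝓝[>] 0) (𝓝 0) := by
    have := (hm₀.sub ht0).abs; rwa [sub_self, abs_zero] at this
  have h2 : Tendsto (fun δ : ℝ => δ * 2) (𝓝[>] 0) (𝓝 0) := by
    have : Tendsto (fun δ : ℝ => δ * 2) (𝓝 0) (𝓝 (0 * 2)) := tendsto_id.mul tendsto_const_nhds
    rw [zero_mul] at this
    exact this.mono_left nhdsWithin_le_nhds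
  have := (hs1.add hs0).add h2
  rw [add_zero, add_zero] at this
  refine this.congr' ?_
  filter_upwards [self_mem_nhdsWithin] with δ (hδ : 0 < δ)
  push_cast
  rw [abs_sub_comm (δ * (m δ : ℝ)), abs_sub_comm (δ * (m₀ δ : ℝ)), ← mul_sub, ← mul_sub, abs_mul, abs_mul,
    abs_of_pos hδ, abs_sub_comm ((zdThr 0 (D.pt 1) δ : ℝ)), abs_sub_comm ((zdThr 0 (D.pt 0) δ : ℝ))]
  ring

/-- **Eventually `δ·u δ ≤ ε`** for every `ε > 0`, `u` the float. [folklore] -/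
theorem eventually_delta_mul_float_le {D : DobrushinDomain} {ρ : ℝ} {Λ : ℝ → Finset HexVertex} {m : ℝ → ℤ}
    {b : ℝ → Sym2 HexVertex} (hA : AdmissibleFamily D ρ Λ m b) {a : ℝ → Sym2 HexVertex} {r₀ : ℝ} {m₀ : ℝ → ℤ}
    (hP : PinnedFlatRoot D Λ b (D.pt 0) a r₀ m₀) {ε : ℝ} (hε : 0 < ε) :
    ∀ᶠ δ : ℝ in 𝓝[>] 0, δ * ((|m δ - zdThr 0 (D.pt 1) δ| + |m₀ δ - zdThr 0 (D.pt 0) δ| + 2 : ℤ) : ℝ) ≤ ε :=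
  ((tendsto_order.1 (tendsto_delta_mul_float hA hP)).2 ε hε).mono fun _ h => h.le

/-- **Collinear chart centres joined by a frontier segment carry the same test threshold**
(registered form, sub-goal of `stub_innerPolygonsOfZigzag`). [folklore] -/
theorem zd_zdT_eq_of_segment : ∀ (D : DobrushinDomain) (S : Set ℂ) (x₁ x₀ : ℂ) (ρ r₁ : ℝ), D.carrier ∩ Metric.ball x₁ ρ = {z : ℂ | x₁.im < z.im} ∩ Metric.ball x₁ ρ → D.carrier ∩ Metric.ball x₀ r₁ = {z : ℂ | x₀.im < z.im} ∩ Metric.ball x₀ r₁ → (∀ w ∈ frontier S, w ∉ Metric.ball x₁ (15 * ρ / 16) → w ∉ Metric.ball x₀ (15 * r₁ / 16) → w ∈ D.carrier) → ρ + r₁ ≤ dist x₀ x₁ → 0 ≤ ρ → 0 ≤ r₁ → ∀ (m m₀ : ℤ) (δ : ℝ) (k : Fin 6) (z z' : ℂ), segment ℝ z z' ⊆ frontier S → ((z' - z) * (starRingEnd ℂ) (innerNormal k)).re = 0 → zdT x₁ x₀ ρ r₁ m m₀ δ k z' = zdT x₁ x₀ ρ r₁ m m₀ δ k z :=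
  fun _ _ _ _ _ _ hD1 hD0 hF hsep hρ hr₁ m m₀ δ k _ _ hseg hl => zdT_eq_of_segment hD1 hD0 hF hsep hρ hr₁ m m₀ δ k hseg hl

end Summit.CriticalPhenomena.SAWScalingLimit.Theorems.PolygonParitySqueeze.ZigzagDiscretisation

end
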